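import Summits.AtomisticToContinuum.FouriersLaw.Theorems.OddSectorIrreversibilityResponseDensitySmoothForecast
import Mathlib.Analysis.Calculus.MeanValue
import HarnessLib

/-!
# `HiddenChargeMazur.StaticKubo`, line `birth`, stub `stub_localSmoothingLipschitz` — local smoothing

Helper file (`--supports stmt-AtomisticToContinuum-13510`, crux decl `HiddenChargeMazur.StaticKubo`,
registered stub `stub_localSmoothingLipschitz` of the skeleton `Cruxes/StaticKubo/Lines/birth.lean`, rev 4).

For the pinned anharmonic chain `pinnedChain ω₂ lam β γ` (`ω₂, γ, T_L > 0`, `lam, β, T_R ≥ 0`, `N ≥ 1`),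
a time `t > 0` and levels `R`, `E₁`: there is `C ≥ 0` such that for every measurable `F` with `|F| ≤ 1`
vanishing on `{H > R}`, the forecast `x ↦ P_t F(x) = ∫ F d(transitionKernel t x)` is `C`-Lipschitz on
the energy shell `{H ≤ E₁}`.

Proof: by the smooth transition density of the tree (`pinnedChain_exists_transitionDensity`,
CEHR Prop. 3.2 via Hörmander's theorem, and `pinnedChain_integral_kernel_eq_integral_density`),
`P_t F(x) − P_t F(x') = ∫_{H ≤ R} (p(t,x,y) − p(t,x',y)) F(y) dy`; the mean value inequality on the
convex closed ball `B̄(0, ρ(E₁)) ⊇ {H ≤ E₁}` bounds `|p(t,x,y) − p(t,x',y)| ≤ M ‖x − x'‖` with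
`M = sup ‖∂ₓ p(t,·,·)‖` over the compact `B̄(0, ρ(E₁)) × {H ≤ R}`, whence `C = M · vol{H ≤ R}`.
[Cuneo–Eckmann–Hairer–Rey-Bellet 2018, Prop 3.2]
-/

noncomputable section

open MeasureTheory Filter Topology
open scoped NNReal ENNReal
open Literature.MathematicalPhysics.KineticTheory.HeatConduction Literature.MathematicalPhysics.KineticTheory
open Literature.Probability.Process OscillatorChain

namespace Summit.AtomisticToContinuum.FouriersLaw.Cruxes.StaticKubo.Birth.Stubs

/-- Mean value inequality in the first variable, uniformly in the second: for a `C¹` function `G`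
of two variables, a convex compact `K` and a compact `S`, there is `M ≥ 0` with
`|G(x, y) − G(x', y)| ≤ M ‖x − x'‖` for `y ∈ S`, `x, x' ∈ K`. -/
theorem abs_sub_le_of_contDiff_fst {E E' : Type*} [NormedAddCommGroup E] [NormedSpace ℝ E]
    [NormedAddCommGroup E'] [NormedSpace ℝ E'] {G : E × E' → ℝ} (hG : ContDiff ℝ 1 G)
    {K : Set E} {S : Set E'} (hK : IsCompact K) (hKc : Convex ℝ K) (hS : IsCompact S) :
    ∃ M : ℝ, 0 ≤ M ∧ ∀ y ∈ S, ∀ x ∈ K, ∀ x' ∈ K, |G (x, y) - G (x', y)| ≤ M * ‖x - x'‖ := by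
  have hcont : Continuous fun w : E × E' =>
      (fderiv ℝ G w).comp (ContinuousLinearMap.inl ℝ E E') :=
    (hG.continuous_fderiv one_ne_zero).clm_comp continuous_const
  obtain ⟨M, hM⟩ := (hK.prod hS).exists_bound_of_continuousOn hcont.continuousOn
  refine ⟨max M 0, le_max_right _ _, fun y hy x hx x' hx' => ?_⟩
  have hf : ∀ z ∈ K, HasFDerivWithinAt (fun z : E => G (z, y))
      ((fderiv ℝ G (z, y)).comp (ContinuousLinearMap.inl ℝ E E')) K z := by
    intro z _
    refine HasFDerivAt.hasFDerivWithinAt ?_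
    exact (hG.differentiable one_ne_zero (z, y)).hasFDerivAt.comp z (hasFDerivAt_prodMk_left z y)
  have hb : ∀ z ∈ K, ‖(fderiv ℝ G (z, y)).comp (ContinuousLinearMap.inl ℝ E E')‖ ≤ max M 0 :=
    fun z hz => (hM (z, y) ⟨hz, hy⟩).trans (le_max_left _ _)
  have h := hKc.norm_image_sub_le_of_norm_hasFDerivWithin_le hf hb hx' hx
  rwa [Real.norm_eq_abs] at h

/-- The Lipschitz estimate from a smooth density: if the kernels `κ x` have a density
`y ↦ G (x, y)` with `G ∈ C¹`, then for measurable `|F| ≤ 1` vanishing off a compact `S` and `x, x'` in a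
convex compact `K`, `|∫ G(x,y) F(y) dy − ∫ G(x',y) F(y) dy| ≤ M vol(S) ‖x − x'‖`. -/
theorem abs_integral_sub_le_of_contDiff_density {N : ℕ} {G : PhaseSpace N × PhaseSpace N → ℝ}
    (hG : ContDiff ℝ 1 G) {K S : Set (PhaseSpace N)} (hK : IsCompact K) (hKc : Convex ℝ K)
    (hS : IsCompact S) :
    ∃ C : ℝ, 0 ≤ C ∧ ∀ F : PhaseSpace N → ℝ, Measurable F → (∀ y, |F y| ≤ 1) →
      (∀ y, y ∉ S → F y = 0) → ∀ x ∈ K, ∀ x' ∈ K,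
        |(∫ y, G (x, y) * F y) - ∫ y, G (x', y) * F y| ≤ C * ‖x - x'‖ := by
  haveI := isAddHaarMeasure_volume_phaseSpace N
  obtain ⟨M, hM0, hM⟩ := abs_sub_le_of_contDiff_fst hG hK hKc hS
  have hSm : MeasurableSet S := hS.measurableSet
  refine ⟨M * (volume S).toReal, by positivity, fun F hFm hF1 hFS x hx x' hx' => ?_⟩
  -- integrability of the two integrands (bounded, measurable, supported in the compact `S`)
  have hI : ∀ z : PhaseSpace N, Integrable (fun y => G (z, y) * F y) volume := by
    intro z
    have hcz : Continuous fun y => G (z, y) := hG.continuous.comp (by fun_prop)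
    have h1 : IntegrableOn (fun y => G (z, y) * F y) S volume := by
      have h2 : IntegrableOn (fun y => G (z, y)) S volume := hcz.continuousOn.integrableOn_compact hS
      have h3 : IntegrableOn (fun y => F y * G (z, y)) S volume :=
        h2.bdd_mul hFm.aestronglyMeasurable
          (Eventually.of_forall fun y => by rw [Real.norm_eq_abs]; exact hF1 y)
      simpa only [mul_comm] using h3
    rw [← integrable_indicator_iff hSm] at h1
    refine h1.congr (Eventually.of_forall fun y => ?_)
    show S.indicator (fun y => G (z, y) * F y) y = G (z, y) * F y
    by_cases hy : y ∈ S
    · rw [Set.indicator_of_mem hy]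
    · rw [Set.indicator_of_notMem hy, hFS y hy, mul_zero]
  rw [← integral_sub (hI x) (hI x')]
  have e3 : ∫ y, (G (x, y) * F y - G (x', y) * F y) = ∫ y in S, (G (x, y) * F y - G (x', y) * F y) := by
    refine (setIntegral_eq_integral_of_forall_compl_eq_zero fun y hy => ?_).symm
    rw [hFS y hy, mul_zero, mul_zero, sub_zero]
  rw [e3]
  have e4 := norm_setIntegral_le_of_norm_le_const (μ := (volume : Measure (PhaseSpace N)))
    (f := fun y => G (x, y) * F y - G (x', y) * F y) (C := M * ‖x - x'‖) hS.measure_lt_top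
    (fun y hy => by
      rw [← sub_mul, norm_mul, Real.norm_eq_abs, Real.norm_eq_abs]
      calc |G (x, y) - G (x', y)| * |F y| ≤ M * ‖x - x'‖ * 1 :=
            mul_le_mul (hM y hy x hx x' hx') (hF1 y) (abs_nonneg _) (by positivity)
        _ = M * ‖x - x'‖ := mul_one _)
  rw [Real.norm_eq_abs, measureReal_def] at e4
  calc |∫ y in S, (G (x, y) * F y - G (x', y) * F y)| ≤ M * ‖x - x'‖ * (volume S).toReal := e4
    _ = M * (volume S).toReal * ‖x - x'‖ := by ring

/-- **S4 — `stub_localSmoothingLipschitz` (local smoothing on an energy shell for shell-supported data),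
proved.** For `t > 0`, `R`, `E₁`: there is `C ≥ 0` such that for every measurable `F` with `|F| ≤ 1`
vanishing on `{H > R}`, `x ↦ P_tF(x) = ∫ F d(transitionKernel t x)` is `C`-Lipschitz on `{H ≤ E₁}`.
Proof: the smooth density (`pinnedChain_exists_transitionDensity`,
`pinnedChain_integral_kernel_eq_integral_density`):
`|P_tF(x) − P_tF(x')| ≤ ∫_{H≤R} |p(t,x,y) − p(t,x',y)| dy ≤ vol{H≤R} · sup ‖∂_x p‖ · ‖x−x'‖`, the sup over
the compact `B̄(0,ρ) × {H ≤ R}` with `{H ≤ E₁} ⊆ B̄(0,ρ)` (mean value inequality on the convex ball).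
[Cuneo–Eckmann–Hairer–Rey-Bellet 2018, Prop 3.2] -/
theorem stub_localSmoothingLipschitz :
    ∀ ω₂ lam β γ : ℝ, 0 < ω₂ → 0 ≤ lam → 0 ≤ β → 0 < γ → ∀ N : ℕ, 0 < N → ∀ T_L T_R : ℝ, 0 < T_L → 0 ≤ T_R →
      ∀ t : ℝ≥0, 0 < (t : ℝ) → ∀ R E₁ : ℝ, ∃ C : ℝ, 0 ≤ C ∧ ∀ F : PhaseSpace N → ℝ, Measurable F →
        (∀ y, |F y| ≤ 1) → (∀ y, R < (pinnedChain ω₂ lam β γ).hamiltonian N y → F y = 0) →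
        ∀ x x' : PhaseSpace N, (pinnedChain ω₂ lam β γ).hamiltonian N x ≤ E₁ →
          (pinnedChain ω₂ lam β γ).hamiltonian N x' ≤ E₁ →
          |(∫ y, F y ∂((pinnedChain ω₂ lam β γ).transitionKernel N T_L T_R t x)) -
              ∫ y, F y ∂((pinnedChain ω₂ lam β γ).transitionKernel N T_L T_R t x')| ≤ C * ‖x - x'‖ := by
  intro ω₂ lam β γ hω hl hβ hγ N hN T_L T_R hL hR t ht R E₁
  obtain ⟨p, hp, hp0, hpk⟩ :=
    Summit.AtomisticToContinuum.FouriersLaw.Theorems.pinnedChain_exists_transitionDensity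
      hω hl hβ hγ hN hL hR
  -- the compact convex ball containing `{H ≤ E₁}` and the compact shell `{H ≤ R}`
  set K : Set (PhaseSpace N) := Metric.closedBall 0 (pinnedChainSublevelRadius ω₂ E₁) with hK
  set S : Set (PhaseSpace N) := {y | (pinnedChain ω₂ lam β γ).hamiltonian N y ≤ R} with hS
  have hKc : IsCompact K := isCompact_closedBall _ _
  have hKconv : Convex ℝ K := convex_closedBall _ _
  have hSc : IsCompact S :=
    (isCompact_closedBall (0 : PhaseSpace N) (pinnedChainSublevelRadius ω₂ R)).of_isClosed_subset
      (isClosed_le (pinnedChain_continuous_hamiltonian ω₂ lam β γ N) continuous_const)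
      fun y hy => mem_closedBall_zero_iff.2 (pinnedChain_norm_le_sublevelRadius hω hl hβ γ N hy)
  -- the density at the fixed time `t` is `C¹` in `(x, y)`
  set G : PhaseSpace N × PhaseSpace N → ℝ := fun w => p (t : ℝ) w.1 w.2 with hG
  have hGd : ContDiff ℝ 1 G := by
    have h1 : ContDiff ℝ 1 (fun w : PhaseSpace N × PhaseSpace N =>
        (((t : ℝ), w) : ℝ × PhaseSpace N × PhaseSpace N)) := by fun_prop
    exact (hp.of_le (by exact_mod_cast le_top)).comp_contDiff h1 fun w => ⟨ht, Set.mem_univ _⟩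
  obtain ⟨C, hC0, hC⟩ := abs_integral_sub_le_of_contDiff_density hGd hKc hKconv hSc
  refine ⟨C, hC0, fun F hFm hF1 hFR x x' hx hx' => ?_⟩
  have e1 := Summit.AtomisticToContinuum.FouriersLaw.Theorems.pinnedChain_integral_kernel_eq_integral_density
    hp hp0 hpk F ht x
  have e2 := Summit.AtomisticToContinuum.FouriersLaw.Theorems.pinnedChain_integral_kernel_eq_integral_density
    hp hp0 hpk F ht x'
  rw [Real.toNNReal_coe] at e1 e2
  rw [e1, e2]
  exact hC F hFm hF1 (fun y hy => hFR y (not_le.1 hy)) x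
    (mem_closedBall_zero_iff.2 (pinnedChain_norm_le_sublevelRadius hω hl hβ γ N hx)) x'
    (mem_closedBall_zero_iff.2 (pinnedChain_norm_le_sublevelRadius hω hl hβ γ N hx'))

end Summit.AtomisticToContinuum.FouriersLaw.Cruxes.StaticKubo.Birth.Stubs

end
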